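import Mathlib
import Summits.ValiantsHypothesis.ValiantsHypothesis.Theorems.KPlusLogSqLawTropicalBSplitDefs
import Summits.ValiantsHypothesis.ValiantsHypothesis.Theorems.KPlusLogSqLawTropicalCensusRows

/-!
# Route «KPlusLogSqLaw», crux `TropicalB` (stmt-ValiantsHypothesis-19771) — the SINGLE-GAUGE LAW and DUAL REGIMES:
# a dominant chain certified column-wise by ONE affine-in-θ row gauge has `n ≤ Σ_j (N_j − 1) ≤ m(mK − 1)`; with `G` gauges `n < G·m²K`

HONEST FRAMING.  Helper file (cell `pub-symmetroid`, seat val-sym-trop-p5 g10, 2026-08-27) `--supports` the crux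
`Summit.ValiantsHypothesis.ValiantsHypothesis.Theses.KPlusLogSqLaw.TropicalB` (item `stmt-ValiantsHypothesis-19771`, route `KPlusLogSqLaw`,
registered stubs `stub_tropThin` / `stub_tropFat` of `Cruxes/TropicalB/Lines/birth.lean`).  A STRUCTURE theorem about dominant chains of
ARBITRARY designs (vocabulary `IsDominant` / `tropWeight` / `termSign`, unsigned row `DesignRowD` of `…TropicalBSplitDefs`): an ALL-`m`, all-`K`
impossibility statement for a NAMED CLASS of chains, the class containing every structured all-`m` family of the cell.  It does NOT bound
`TropicalB` for general chains; nothing here bears on `TropicalB` in its window, `WeakLifting`, DoorA26 / DoorA34, `MatrixDescartes`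
(stmt-ValiantsHypothesis-18050) or VP ≠ VNP.

THE CLASS.  An AFFINE ROW GAUGE is `α β : Fin m → ℚ`, read as θ-dependent row potentials `u_i(θ) = α i·θ + β i`.  It CERTIFIES the term
`(σ, λ)` at slope `θ` COLUMN-WISE if in every column `j` the term's incidence maximises the gauged score `θ·d l − v i j l − u_i(θ)` over the
PRESENT incidences `(i, l)` of that column (column potentials cancel inside a column).  By LP duality every dominant term has SOME certifying
gauge at its own slope (`isDominant_of_scaledPotential` is the converse in the tree); a SINGLE-GAUGE chain is one all of whose terms are
certified by ONE AND THE SAME affine gauge.  SHIFT-THREE (`…TropicalShiftThree`: gauge `u_a(θ) = −θ(2m+3)·a` of its `phi`) and the DIAMOND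
family `T(m,K) ≥ (K−3)m² + 2m` (`…TropicalShiftDiamondDomination.phi_le`: per-incidence domination under `−θκ·a`) are single-gauge.

THE LAW.
* `card_steps_le` — FIRST-OCCURRENCE COUNTING: `m` sequences on `Fin (n+1)` with the INTERVAL property (equal values at `k₁ < k₃` force that
  value at every `k₂` between) and pairwise distinct value-tuples satisfy `n ≤ Σ_j (#values_j − 1)`.
* `line_interval` — under one affine gauge the gauged LINE (slope `d l − α i`, intercept `v i j l + β i`) of the chain's incidence in a
  fixed column is interval-valued (`affine_sandwich`); `lines_ne_of_ne` — distinct dominant terms certified by one gauge differ in some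
  column's line (else equal weights at the slope where one is the UNIQUE optimum: gauge sums agree for permutations).
* `chain_le_sum_of_gaugePieces` / `chain_le_of_gaugePieces` — **DUAL REGIMES**: if the chain is cut into consecutive pieces (a monotone label
  `Fin (n+1) → Fin G`) each certified by its own affine gauge, then `n ≤ Σ_j (G·N_j − 1) ≤ m·(G·mK − 1)`, `N_j = #{(i,l) : ε i j l ≠ 0}`;
  so a chain of length `n` needs MORE than `n/(m²K)` affine pieces of a certifying row dual.
* `chain_le_of_singleGauge` — **`G = 1`: `n ≤ m·(m·K − 1)`** (column form `Σ_j (N_j − 1)` from the pieces theorem) — quadratic in `m`,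
  linear in `K`, linear in `m` on supports with `O(1)` present incidences per column.
* `designRowD_of_uniformGauge` — a design ONE gauge of which certifies EVERY dominant term at EVERY slope has `DesignRowD d v ε (m(mK − 1))`;
  `tropicalB_shape_of_uniformGauge` — inside the crux's budget with `C = 4`.

READING (located, not claimed; memo SINGLE-GAUGE-g10.md of the seat; LP per segment with exact re-check of the float point).  (i) DIAMOND has
`(K−3)m² + 2m` terms on one gauge against `m(mK − 1) + 1`: ratio `(K−3)/K → 1` — the law is asymptotically sharp in `K` (factor `6` at `K = 3`,
SHIFT-THREE); (ii) the census-tight small designs are the opposite regime: the `(4,4)` tight chain (35 terms, `…TropicalCensusFourFourTight`)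
needs 13 gauge pieces, the `(5,4)` record (50 terms, `…TropicalCensusFiveFourFortyNine`) 16 — a new dual every ≈ 3 terms; (iii) `K = 4` fork:
a CUBIC family needs `G = Ω(m)` dual regimes; every all-`m` construction of the cell has `G = 1`.
[folklore] LP duality for the assignment problem; the packaging («one parametric dual piece covers `≤ Σ_j (N_j − 1) + 1` primal vertices»)
is the cell's.
-/

set_option linter.dupNamespace false
set_option autoImplicit false

namespace Summit.ValiantsHypothesis.ValiantsHypothesis.Theorems.KPlusLogSqLaw

open Summit.ValiantsHypothesis.ValiantsHypothesis.Theorems.MatrixDescartes.Negative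
open Summit.ValiantsHypothesis.ValiantsHypothesis.Theorems.LacunarySymmetroidMatrixDescartes
open Summit.ValiantsHypothesis.ValiantsHypothesis.Theorems.LacunarySymmetroidMatrixDescartes.TropicalCensus
open scoped BigOperators
open Finset

namespace SingleGauge

/-! ## 1. First-occurrence counting (pure combinatorics) -/

/-- **First-occurrence counting.**  Let `c j : Fin (n+1) → X` (`j : Fin m`) be sequences with the INTERVAL property — if `c j` takes
the same value at `k₁ < k₃` then it takes that value at every `k₂` strictly between — and suppose the tuples `k ↦ (c j k)_j` are pairwise
distinct.  Then `n ≤ Σ_j (#values(c j) − 1)`: each index `k ≥ 1` differs from `k − 1` in some column `j`, and by the interval property the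
value `c j k` never occurred in column `j` before `k`; first occurrences after time `0` are at most `#values − 1` per column. [folklore] -/
theorem card_steps_le {X : Type*} [DecidableEq X] {m n : ℕ} (c : Fin m → Fin (n + 1) → X)
    (hint : ∀ (j : Fin m) (k₁ k₂ k₃ : Fin (n + 1)), k₁ < k₂ → k₂ < k₃ → c j k₁ = c j k₃ → c j k₂ = c j k₁)
    (hdist : ∀ k k' : Fin (n + 1), k ≠ k' → ∃ j, c j k ≠ c j k') :
    n ≤ ∑ j : Fin m, ((univ.image (c j)).card - 1) := by
  classical
  -- first occurrences in column j (time 0 included)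
  let N : Fin m → Finset (Fin (n + 1)) := fun j => univ.filter (fun k => ∀ k' : Fin (n + 1), k' < k → c j k' ≠ c j k)
  have h0N : ∀ j, (0 : Fin (n + 1)) ∈ N j := fun j => by
    simp only [N, mem_filter, mem_univ, true_and]
    exact fun k' hk' => absurd hk' (Fin.not_lt_zero k')
  -- (a) every k ≠ 0 is a first occurrence in some column: the column where it differs from its predecessor
  have hcover : univ.erase (0 : Fin (n + 1)) ⊆ univ.biUnion fun j => (N j).erase 0 := by
    intro k hk
    have hk0 : k ≠ 0 := (mem_erase.mp hk).1
    have hkpos : 0 < (k : ℕ) := Nat.pos_of_ne_zero fun h => hk0 (Fin.ext h)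
    let km : Fin (n + 1) := ⟨(k : ℕ) - 1, by omega⟩
    have hkm_lt : km < k := Fin.lt_def.mpr (by show (k : ℕ) - 1 < (k : ℕ); omega)
    obtain ⟨j, hj⟩ := hdist k km (ne_of_gt hkm_lt)
    rw [mem_biUnion]
    refine ⟨j, mem_univ _, mem_erase.mpr ⟨hk0, ?_⟩⟩
    simp only [N, mem_filter, mem_univ, true_and]
    intro k' hk' heq
    -- k' < k with the same value: either k' = km (contradiction) or k' < km < k (interval property)
    rcases lt_or_eq_of_le (show (k' : ℕ) ≤ (km : ℕ) by
        have : (k' : ℕ) < (k : ℕ) := hk'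
        show (k' : ℕ) ≤ (k : ℕ) - 1
        omega) with hlt | heqv
    · have := hint j k' km k (Fin.lt_def.mpr hlt) hkm_lt heq
      exact hj (by rw [this, heq])
    · rw [Fin.ext heqv] at heq
      exact hj heq.symm
  -- (b) `c j` is injective on first occurrences, so `#(N j) ≤ #values`
  have hN : ∀ j, (N j).card ≤ (univ.image (c j)).card := by
    intro j
    refine card_le_card_of_injOn (c j) (fun a _ => mem_image_of_mem _ (mem_univ a)) ?_
    intro a ha b hb hab
    simp only [mem_coe, N, mem_filter, mem_univ, true_and] at ha hb
    rcases lt_trichotomy a b with h | h | h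
    · exact absurd hab (hb a h)
    · exact h
    · exact absurd hab.symm (ha b h)
  -- (c) assemble
  calc n = (univ.erase (0 : Fin (n + 1))).card := by rw [card_erase_of_mem (mem_univ _), card_univ, Fintype.card_fin]; omega
    _ ≤ (univ.biUnion fun j => (N j).erase 0).card := card_le_card hcover
    _ ≤ ∑ j, ((N j).erase 0).card := card_biUnion_le
    _ ≤ ∑ j : Fin m, ((univ.image (c j)).card - 1) := sum_le_sum fun j _ => by
        rw [card_erase_of_mem (h0N j)]; exact Nat.sub_le_sub_right (hN j) 1

/-! ## 2. Affine sandwich -/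

/-- **Affine sandwich.**  Two affine functions `a·θ + b` and `a'·θ + b'` of a rational variable: if the first is `≥` the second at
`θ₁` and at `θ₃`, and `≤` it at some `θ₂` with `θ₁ < θ₂ < θ₃`, then they coincide. [folklore] -/
theorem affine_sandwich {a b a' b' θ₁ θ₂ θ₃ : ℚ} (h12 : θ₁ < θ₂) (h23 : θ₂ < θ₃)
    (h1 : a' * θ₁ + b' ≤ a * θ₁ + b) (h2 : a * θ₂ + b ≤ a' * θ₂ + b') (h3 : a' * θ₃ + b' ≤ a * θ₃ + b) :
    a = a' ∧ b = b' := by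
  have ha : a = a' := by
    rcases lt_trichotomy a a' with h | h | h
    · exfalso; nlinarith
    · exact h
    · exfalso; nlinarith
  subst ha
  constructor
  · rfl
  · linarith

/-! ## 3. The single-gauge law -/

variable {m K : ℕ}

/-- **Interval property of the chain's lines in a fixed column.**  Three terms `q₁, q₂, q₃` at rational slopes `t₁ < t₂ < t₃`; the
incidence of `q₂` in column `j` scores at most that of `q₁` under the affine row gauge `(α, β)` at `t₁` (`c1`) and at most that of `q₃` at
`t₃` (`c3`), and the incidence of `q₁` scores at most that of `q₂` at `t₂` (`c2`).  If the incidences of `q₁` and `q₃` in column `j` have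
the same gauged LINE (slope `d l − α i`, intercept `v i j l + β i`), then so does the incidence of `q₂`. [folklore] -/
theorem line_interval (d : Fin K → ℕ) (v : Fin m → Fin m → Fin K → ℤ) (α β : Fin m → ℚ) {t₁ t₂ t₃ : ℚ}
    (h12 : t₁ < t₂) (h23 : t₂ < t₃) (q₁ q₂ q₃ : Equiv.Perm (Fin m) × (Fin m → Fin K)) (j : Fin m)
    (c1 : (t₁ * (d (q₂.2 j) : ℚ) - (v (q₂.1 j) j (q₂.2 j) : ℚ)) - (α (q₂.1 j) * t₁ + β (q₂.1 j)) ≤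
      (t₁ * (d (q₁.2 j) : ℚ) - (v (q₁.1 j) j (q₁.2 j) : ℚ)) - (α (q₁.1 j) * t₁ + β (q₁.1 j)))
    (c2 : (t₂ * (d (q₁.2 j) : ℚ) - (v (q₁.1 j) j (q₁.2 j) : ℚ)) - (α (q₁.1 j) * t₂ + β (q₁.1 j)) ≤
      (t₂ * (d (q₂.2 j) : ℚ) - (v (q₂.1 j) j (q₂.2 j) : ℚ)) - (α (q₂.1 j) * t₂ + β (q₂.1 j)))
    (c3 : (t₃ * (d (q₂.2 j) : ℚ) - (v (q₂.1 j) j (q₂.2 j) : ℚ)) - (α (q₂.1 j) * t₃ + β (q₂.1 j)) ≤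
      (t₃ * (d (q₃.2 j) : ℚ) - (v (q₃.1 j) j (q₃.2 j) : ℚ)) - (α (q₃.1 j) * t₃ + β (q₃.1 j)))
    (heq : ((d (q₁.2 j) : ℚ) - α (q₁.1 j), (v (q₁.1 j) j (q₁.2 j) : ℚ) + β (q₁.1 j)) =
      ((d (q₃.2 j) : ℚ) - α (q₃.1 j), (v (q₃.1 j) j (q₃.2 j) : ℚ) + β (q₃.1 j))) :
    ((d (q₂.2 j) : ℚ) - α (q₂.1 j), (v (q₂.1 j) j (q₂.2 j) : ℚ) + β (q₂.1 j)) =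
      ((d (q₁.2 j) : ℚ) - α (q₁.1 j), (v (q₁.1 j) j (q₁.2 j) : ℚ) + β (q₁.1 j)) := by
  revert c1 c2 c3 heq
  -- name the incidence data
  generalize q₁.1 j = i₁
  generalize q₁.2 j = l₁
  generalize q₂.1 j = i₂
  generalize q₂.2 j = l₂
  generalize q₃.1 j = i₃
  generalize q₃.2 j = l₃
  intro c1 c2 c3 heq
  -- line data of q₃ equals that of q₁
  have e1 : (d l₃ : ℚ) - α i₃ = (d l₁ : ℚ) - α i₁ := (congrArg Prod.fst heq).symm
  have e2 : (v i₃ j l₃ : ℚ) + β i₃ = (v i₁ j l₁ : ℚ) + β i₁ := (congrArg Prod.snd heq).symm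
  -- affine comparisons of the lines L₁ = (a, -b) and L₂ = (a', -b')
  have h1 : ((d l₂ : ℚ) - α i₂) * t₁ + (-((v i₂ j l₂ : ℚ) + β i₂)) ≤
      ((d l₁ : ℚ) - α i₁) * t₁ + (-((v i₁ j l₁ : ℚ) + β i₁)) := by linarith
  have h2 : ((d l₁ : ℚ) - α i₁) * t₂ + (-((v i₁ j l₁ : ℚ) + β i₁)) ≤
      ((d l₂ : ℚ) - α i₂) * t₂ + (-((v i₂ j l₂ : ℚ) + β i₂)) := by linarith
  have h3 : ((d l₂ : ℚ) - α i₂) * t₃ + (-((v i₂ j l₂ : ℚ) + β i₂)) ≤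
      ((d l₁ : ℚ) - α i₁) * t₃ + (-((v i₁ j l₁ : ℚ) + β i₁)) := by
    have e1' : (d l₃ : ℚ) = (d l₁ : ℚ) - α i₁ + α i₃ := by linarith
    have e2' : (v i₃ j l₃ : ℚ) = (v i₁ j l₁ : ℚ) + β i₁ - β i₃ := by linarith
    rw [e1', e2'] at c3
    linarith
  obtain ⟨ha, hb⟩ := affine_sandwich h12 h23 h1 h2 h3
  refine Prod.ext ?_ ?_
  · exact ha.symm
  · show (v i₂ j l₂ : ℚ) + β i₂ = (v i₁ j l₁ : ℚ) + β i₁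
    linarith

/-- **Distinct certified dominant terms have distinct line tuples.**  If two DISTINCT terms `q` (dominant at `θ`) and `q'` (present) are
both certified column-wise by the same affine gauge — `q` at `θ`, and `q'` has in every column the same gauged line as `q` — we get a
contradiction: the weights of `q` and `q'` at `θ` differ by the gauge sums `Σ_i u_i(θ)`, which agree for permutations. [folklore] -/
theorem lines_ne_of_ne (d : Fin K → ℕ) (v ε : Fin m → Fin m → Fin K → ℤ) (α β : Fin m → ℚ) (θ₀ : ℤ)
    (q q' : Equiv.Perm (Fin m) × (Fin m → Fin K)) (hne : q ≠ q') (hq : IsDominant d v ε θ₀ q) (hq' : termSign ε q' ≠ 0)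
    (hlines : ∀ j : Fin m,
      ((d (q'.2 j) : ℚ) - α (q'.1 j), (v (q'.1 j) j (q'.2 j) : ℚ) + β (q'.1 j)) =
        ((d (q.2 j) : ℚ) - α (q.1 j), (v (q.1 j) j (q.2 j) : ℚ) + β (q.1 j))) : False := by
  have hlt := hq.2 q' (Ne.symm hne) hq'
  -- the weights are equal
  have heqw : (tropWeight d v θ₀ q' : ℚ) = (tropWeight d v θ₀ q : ℚ) := by
    rw [tropWeight_eq_sum, tropWeight_eq_sum]
    push_cast
    -- per column: (θ d l' − v') − (θ d l − v) = (α i' − α i) θ + (β i' − β i)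
    have hcol : ∀ j : Fin m, ((θ₀ : ℚ) * (d (q'.2 j) : ℚ) - (v (q'.1 j) j (q'.2 j) : ℚ)) =
        ((θ₀ : ℚ) * (d (q.2 j) : ℚ) - (v (q.1 j) j (q.2 j) : ℚ)) + ((α (q'.1 j) - α (q.1 j)) * (θ₀ : ℚ) + (β (q'.1 j) - β (q.1 j))) := by
      intro j
      have e1 : (d (q'.2 j) : ℚ) - α (q'.1 j) = (d (q.2 j) : ℚ) - α (q.1 j) := congrArg Prod.fst (hlines j)
      have e2 : (v (q'.1 j) j (q'.2 j) : ℚ) + β (q'.1 j) = (v (q.1 j) j (q.2 j) : ℚ) + β (q.1 j) := congrArg Prod.snd (hlines j)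
      have e1' : (d (q'.2 j) : ℚ) = (d (q.2 j) : ℚ) - α (q.1 j) + α (q'.1 j) := by linarith
      have e2' : (v (q'.1 j) j (q'.2 j) : ℚ) = (v (q.1 j) j (q.2 j) : ℚ) + β (q.1 j) - β (q'.1 j) := by linarith
      rw [e1', e2']
      ring
    rw [Finset.sum_congr rfl fun j _ => hcol j, Finset.sum_add_distrib]
    -- the gauge sums agree for the two permutations
    have hg : ∑ j, ((α (q'.1 j) - α (q.1 j)) * (θ₀ : ℚ) + (β (q'.1 j) - β (q.1 j))) = 0 := by
      have s1 : ∑ j, (α (q'.1 j) * (θ₀ : ℚ) + β (q'.1 j)) = ∑ i, (α i * (θ₀ : ℚ) + β i) :=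
        Equiv.sum_comp q'.1 (fun i => α i * (θ₀ : ℚ) + β i)
      have s2 : ∑ j, (α (q.1 j) * (θ₀ : ℚ) + β (q.1 j)) = ∑ i, (α i * (θ₀ : ℚ) + β i) :=
        Equiv.sum_comp q.1 (fun i => α i * (θ₀ : ℚ) + β i)
      have : ∑ j, ((α (q'.1 j) - α (q.1 j)) * (θ₀ : ℚ) + (β (q'.1 j) - β (q.1 j))) =
          ∑ j, (α (q'.1 j) * (θ₀ : ℚ) + β (q'.1 j)) - ∑ j, (α (q.1 j) * (θ₀ : ℚ) + β (q.1 j)) := by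
        rw [← Finset.sum_sub_distrib]
        refine Finset.sum_congr rfl fun j _ => ?_
        ring
      rw [this, s1, s2, sub_self]
    rw [hg, add_zero]
  have : tropWeight d v θ₀ q' = tropWeight d v θ₀ q := by exact_mod_cast heqw
  exact absurd this (ne_of_lt hlt)

/-- **DUAL REGIMES (column form).**  Let `p₀, …, pₙ` be dominant at strictly increasing integer slopes with consecutive terms distinct,
and let the index set be cut into consecutive pieces by a MONOTONE label `g : Fin (n+1) → Fin G`, piece `t` carrying an affine row gauge
`u_i(θ) = α t i·θ + β t i` that certifies its terms COLUMN-WISE (each incidence of `p k` maximises the gauged score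
`θ k·d l − v i j l − u_i(θ k)` over the present incidences `(i, l)` of its column).  Then `n ≤ Σ_j (G·N_j − 1)`, `N_j = #{(i, l) : ε i j l ≠ 0}`.
[folklore LP duality; packaging of the cell] -/
theorem chain_le_sum_of_gaugePieces (d : Fin K → ℕ) (v ε : Fin m → Fin m → Fin K → ℤ) {G : ℕ} (α β : Fin G → Fin m → ℚ) {n : ℕ}
    (θ : Fin (n + 1) → ℤ) (hθ : StrictMono θ) (p : Fin (n + 1) → Equiv.Perm (Fin m) × (Fin m → Fin K))
    (hdom : ∀ k, IsDominant d v ε (θ k) (p k)) (hne : ∀ k : Fin n, p k.castSucc ≠ p k.succ)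
    (g : Fin (n + 1) → Fin G) (hg : Monotone g)
    (hcert : ∀ (k : Fin (n + 1)) (j i : Fin m) (l : Fin K), ε i j l ≠ 0 →
      ((θ k : ℚ) * (d l : ℚ) - (v i j l : ℚ)) - (α (g k) i * (θ k : ℚ) + β (g k) i) ≤
        ((θ k : ℚ) * (d ((p k).2 j) : ℚ) - (v ((p k).1 j) j ((p k).2 j) : ℚ)) -
          (α (g k) ((p k).1 j) * (θ k : ℚ) + β (g k) ((p k).1 j))) :
    n ≤ ∑ j : Fin m, (G * (((univ : Finset (Fin m × Fin K)).filter (fun il => ε il.1 j il.2 ≠ 0)).card) - 1) := by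
  classical
  -- labelled lines: (piece, line under that piece's gauge)
  let c : Fin m → Fin (n + 1) → Fin G × (ℚ × ℚ) := fun j k =>
    (g k, ((d ((p k).2 j) : ℚ) - α (g k) ((p k).1 j), (v ((p k).1 j) j ((p k).2 j) : ℚ) + β (g k) ((p k).1 j)))
  have hinj : Function.Injective p := injective_of_chainD d v ε θ p hθ hdom hne
  have hpres : ∀ k j, ε ((p k).1 j) j ((p k).2 j) ≠ 0 := fun k j => present_of_termSign_ne_zero ε (p k) (hdom k).1 j
  -- interval property: equal labels at k₁ < k₃ force the same piece in between (monotone label), then `line_interval`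
  have hint : ∀ (j : Fin m) (k₁ k₂ k₃ : Fin (n + 1)), k₁ < k₂ → k₂ < k₃ → c j k₁ = c j k₃ → c j k₂ = c j k₁ := by
    intro j k₁ k₂ k₃ h12 h23 heq
    have hg13 : g k₁ = g k₃ := congrArg Prod.fst heq
    have hg12 : g k₂ = g k₁ := le_antisymm (hg13 ▸ hg h23.le) (hg h12.le)
    have t12 : (θ k₁ : ℚ) < (θ k₂ : ℚ) := by exact_mod_cast hθ h12
    have t23 : (θ k₂ : ℚ) < (θ k₃ : ℚ) := by exact_mod_cast hθ h23
    have c1 := hcert k₁ j _ _ (hpres k₂ j)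
    have c2 := hcert k₂ j _ _ (hpres k₁ j)
    have c3 := hcert k₃ j _ _ (hpres k₂ j)
    rw [hg12] at c2
    rw [← hg13] at c3
    have h2 : ((d ((p k₁).2 j) : ℚ) - α (g k₁) ((p k₁).1 j), (v ((p k₁).1 j) j ((p k₁).2 j) : ℚ) + β (g k₁) ((p k₁).1 j)) =
        ((d ((p k₃).2 j) : ℚ) - α (g k₃) ((p k₃).1 j), (v ((p k₃).1 j) j ((p k₃).2 j) : ℚ) + β (g k₃) ((p k₃).1 j)) :=
      congrArg Prod.snd heq
    rw [← hg13] at h2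
    have hl := line_interval d v (α (g k₁)) (β (g k₁)) t12 t23 (p k₁) (p k₂) (p k₃) j c1 c2 c3 h2
    refine Prod.ext hg12 ?_
    show ((d ((p k₂).2 j) : ℚ) - α (g k₂) ((p k₂).1 j), (v ((p k₂).1 j) j ((p k₂).2 j) : ℚ) + β (g k₂) ((p k₂).1 j)) =
      ((d ((p k₁).2 j) : ℚ) - α (g k₁) ((p k₁).1 j), (v ((p k₁).1 j) j ((p k₁).2 j) : ℚ) + β (g k₁) ((p k₁).1 j))
    rw [hg12]
    exact hl
  -- distinct tuples
  have hdist : ∀ k k' : Fin (n + 1), k ≠ k' → ∃ j, c j k ≠ c j k' := by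
    intro k k' hkk'
    by_contra hcon
    push Not at hcon
    have hpk : p k ≠ p k' := fun h => hkk' (hinj h)
    rcases Nat.eq_zero_or_pos m with hm | hm
    · -- no columns: all terms coincide
      subst hm
      exact hpk (Prod.ext (Subsingleton.elim _ _) (funext fun j => Fin.elim0 j))
    · have j₀ : Fin m := ⟨0, hm⟩
      have hgk : g k' = g k := congrArg Prod.fst (hcon j₀).symm
      refine lines_ne_of_ne d v ε (α (g k)) (β (g k)) (θ k) (p k) (p k') hpk (hdom k) (hdom k').1 fun j => ?_
      have h2 : ((d ((p k).2 j) : ℚ) - α (g k) ((p k).1 j), (v ((p k).1 j) j ((p k).2 j) : ℚ) + β (g k) ((p k).1 j)) =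
          ((d ((p k').2 j) : ℚ) - α (g k') ((p k').1 j), (v ((p k').1 j) j ((p k').2 j) : ℚ) + β (g k') ((p k').1 j)) :=
        congrArg Prod.snd (hcon j)
      rw [hgk] at h2
      exact h2.symm
  -- counting: the values of c j are (piece, line of a PRESENT incidence of column j)
  refine (card_steps_le c hint hdist).trans (sum_le_sum fun j _ => ?_)
  have hsub : univ.image (c j) ⊆ ((univ : Finset (Fin G)) ×ˢ
      ((univ : Finset (Fin m × Fin K)).filter (fun il => ε il.1 j il.2 ≠ 0))).image
      (fun til => (til.1, ((d til.2.2 : ℚ) - α til.1 til.2.1, (v til.2.1 j til.2.2 : ℚ) + β til.1 til.2.1))) := by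
    intro x hx
    rw [mem_image] at hx ⊢
    obtain ⟨k, _, hk⟩ := hx
    refine ⟨(g k, ((p k).1 j, (p k).2 j)), ?_, hk⟩
    simp only [mem_product, mem_univ, true_and, mem_filter]
    exact hpres k j
  have := ((card_le_card hsub).trans card_image_le).trans (card_product _ _).le
  rw [card_univ, Fintype.card_fin] at this
  omega

/-- **DUAL REGIMES.**  Under the hypotheses of `chain_le_sum_of_gaugePieces`: `n ≤ m·(G·(m·K) − 1)` — a chain certified by `G` affine
pieces of a row dual is `O(G·m²K)`; equivalently a chain of length `n` needs MORE than `n/(m²K)` dual regimes (for the cell's `K = 4` fork: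
a cubic family needs `Ω(m)` regimes). [packaging of the cell] -/
theorem chain_le_of_gaugePieces (d : Fin K → ℕ) (v ε : Fin m → Fin m → Fin K → ℤ) {G : ℕ} (α β : Fin G → Fin m → ℚ) {n : ℕ}
    (θ : Fin (n + 1) → ℤ) (hθ : StrictMono θ) (p : Fin (n + 1) → Equiv.Perm (Fin m) × (Fin m → Fin K))
    (hdom : ∀ k, IsDominant d v ε (θ k) (p k)) (hne : ∀ k : Fin n, p k.castSucc ≠ p k.succ)
    (g : Fin (n + 1) → Fin G) (hg : Monotone g)
    (hcert : ∀ (k : Fin (n + 1)) (j i : Fin m) (l : Fin K), ε i j l ≠ 0 →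
      ((θ k : ℚ) * (d l : ℚ) - (v i j l : ℚ)) - (α (g k) i * (θ k : ℚ) + β (g k) i) ≤
        ((θ k : ℚ) * (d ((p k).2 j) : ℚ) - (v ((p k).1 j) j ((p k).2 j) : ℚ)) -
          (α (g k) ((p k).1 j) * (θ k : ℚ) + β (g k) ((p k).1 j))) :
    n ≤ m * (G * (m * K) - 1) := by
  classical
  refine (chain_le_sum_of_gaugePieces d v ε α β θ hθ p hdom hne g hg hcert).trans ?_
  have hb : ∀ j : Fin m, G * ((univ : Finset (Fin m × Fin K)).filter (fun il => ε il.1 j il.2 ≠ 0)).card - 1 ≤ G * (m * K) - 1 := by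
    intro j
    have : ((univ : Finset (Fin m × Fin K)).filter (fun il => ε il.1 j il.2 ≠ 0)).card ≤ m * K := by
      calc _ ≤ (univ : Finset (Fin m × Fin K)).card := card_filter_le _ _
        _ = m * K := by rw [card_univ, Fintype.card_prod, Fintype.card_fin, Fintype.card_fin]
    have := Nat.mul_le_mul_left G this
    omega
  calc ∑ j : Fin m, (G * ((univ : Finset (Fin m × Fin K)).filter (fun il => ε il.1 j il.2 ≠ 0)).card - 1)
      ≤ (univ : Finset (Fin m)).card • (G * (m * K) - 1) := sum_le_card_nsmul _ _ _ fun j _ => hb j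
    _ = m * (G * (m * K) - 1) := by rw [card_univ, Fintype.card_fin, smul_eq_mul]

/-! ## 4. One gauge -/

/-- **THE SINGLE-GAUGE LAW.**  Let `p₀, …, pₙ` be dominant at strictly increasing integer slopes with consecutive terms distinct, and let
ONE affine row gauge `u_i(θ) = α i·θ + β i` certify every `p k` at `θ k` column-wise.  Then **`n ≤ m·(m·K − 1)`** — quadratic in `m`,
linear in `K`, at every format (column form `n ≤ Σ_j (N_j − 1)`: `chain_le_sum_of_gaugePieces` with `G = 1`). [packaging of the cell] -/
theorem chain_le_of_singleGauge (d : Fin K → ℕ) (v ε : Fin m → Fin m → Fin K → ℤ) (α β : Fin m → ℚ) {n : ℕ}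
    (θ : Fin (n + 1) → ℤ) (hθ : StrictMono θ) (p : Fin (n + 1) → Equiv.Perm (Fin m) × (Fin m → Fin K))
    (hdom : ∀ k, IsDominant d v ε (θ k) (p k)) (hne : ∀ k : Fin n, p k.castSucc ≠ p k.succ)
    (hcert : ∀ (k : Fin (n + 1)) (j i : Fin m) (l : Fin K), ε i j l ≠ 0 →
      ((θ k : ℚ) * (d l : ℚ) - (v i j l : ℚ)) - (α i * (θ k : ℚ) + β i) ≤
        ((θ k : ℚ) * (d ((p k).2 j) : ℚ) - (v ((p k).1 j) j ((p k).2 j) : ℚ)) - (α ((p k).1 j) * (θ k : ℚ) + β ((p k).1 j))) :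
    n ≤ m * (m * K - 1) := by
  have h := chain_le_of_gaugePieces d v ε (fun _ : Fin 1 => α) (fun _ => β) θ hθ p hdom hne (fun _ => 0)
    (fun _ _ _ => le_rfl) hcert
  simpa only [one_mul] using h

/-! ## 5. Sector form: uniformly rigid designs -/

/-- **Uniformly rigid designs are quadratic.**  If ONE affine row gauge `(α, β)` certifies column-wise EVERY term that is dominant at ANY
integer slope of the design `(d, v, ε)` («uniformly rigid design», e.g. the rotation skeleton of SHIFT-THREE with its gauge), then the
design's unsigned row is `DesignRowD d v ε (m·(m·K − 1))`. [packaging of the cell] -/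
theorem designRowD_of_uniformGauge (d : Fin K → ℕ) (v ε : Fin m → Fin m → Fin K → ℤ) (α β : Fin m → ℚ)
    (hrig : ∀ (θ₀ : ℤ) (q : Equiv.Perm (Fin m) × (Fin m → Fin K)), IsDominant d v ε θ₀ q →
      ∀ (j i : Fin m) (l : Fin K), ε i j l ≠ 0 →
        ((θ₀ : ℚ) * (d l : ℚ) - (v i j l : ℚ)) - (α i * (θ₀ : ℚ) + β i) ≤
          ((θ₀ : ℚ) * (d (q.2 j) : ℚ) - (v (q.1 j) j (q.2 j) : ℚ)) - (α (q.1 j) * (θ₀ : ℚ) + β (q.1 j))) :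
    DesignRowD d v ε (m * (m * K - 1)) :=
  fun _ θ p hθ hdom hne => chain_le_of_singleGauge d v ε α β θ hθ p hdom hne (fun k j i l h => hrig (θ k) (p k) (hdom k) j i l h)

/-- arithmetic: `m·(m·K − 1) ≤ 2^{4(K + ⌊log₂ m⌋²)}`. [folklore] -/
theorem quad_le_two_pow (m K : ℕ) : m * (m * K - 1) ≤ 2 ^ (4 * (K + Nat.log 2 m ^ 2)) := by
  rcases Nat.eq_zero_or_pos K with hK | hK
  · subst hK; simp
  rcases Nat.eq_zero_or_pos m with hm | hm
  · subst hm; simp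
  set L := Nat.log 2 m with hL
  have hmlt : m < 2 ^ (L + 1) := hL ▸ Nat.lt_pow_succ_log_self (by norm_num) m
  have hKle : K ≤ 2 ^ K := Nat.lt_two_pow_self.le
  calc m * (m * K - 1) ≤ m * (m * K) := Nat.mul_le_mul_left _ (Nat.sub_le _ _)
    _ ≤ 2 ^ (L + 1) * (2 ^ (L + 1) * 2 ^ K) :=
        Nat.mul_le_mul hmlt.le (Nat.mul_le_mul hmlt.le hKle)
    _ = 2 ^ (2 * L + 2 + K) := by rw [← pow_add, ← pow_add]; ring_nf
    _ ≤ 2 ^ (4 * (K + L ^ 2)) := by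
        apply Nat.pow_le_pow_right (by norm_num)
        rcases Nat.eq_zero_or_pos L with hL0 | hL0
        · rw [hL0]; omega
        · nlinarith

/-- **Crux currency.**  On uniformly rigid designs the crux's inequality holds with `C = 4`: every sign-alternating dominant chain has
`n ≤ 2^{4(K + ⌊log₂ m⌋²)}` (indeed `≤ m(mK − 1)`).  The crux `TropicalB` itself (all designs) is NOT touched. [packaging of the cell] -/
theorem tropicalB_shape_of_uniformGauge (d : Fin K → ℕ) (v ε : Fin m → Fin m → Fin K → ℤ) (α β : Fin m → ℚ)
    (hrig : ∀ (θ₀ : ℤ) (q : Equiv.Perm (Fin m) × (Fin m → Fin K)), IsDominant d v ε θ₀ q →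
      ∀ (j i : Fin m) (l : Fin K), ε i j l ≠ 0 →
        ((θ₀ : ℚ) * (d l : ℚ) - (v i j l : ℚ)) - (α i * (θ₀ : ℚ) + β i) ≤
          ((θ₀ : ℚ) * (d (q.2 j) : ℚ) - (v (q.1 j) j (q.2 j) : ℚ)) - (α (q.1 j) * (θ₀ : ℚ) + β (q.1 j)))
    {n : ℕ} (θ : Fin (n + 1) → ℤ) (p : Fin (n + 1) → Equiv.Perm (Fin m) × (Fin m → Fin K))
    (hθ : StrictMono θ) (hdom : ∀ k, IsDominant d v ε (θ k) (p k))
    (halt : ∀ k : Fin n, termSign ε (p k.castSucc) * termSign ε (p k.succ) < 0) :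
    n ≤ 2 ^ (4 * (K + Nat.log 2 m ^ 2)) :=
  (le_of_designRowD (designRowD_of_uniformGauge d v ε α β hrig) θ p hθ hdom halt).trans (quad_le_two_pow m K)

end SingleGauge

end Summit.ValiantsHypothesis.ValiantsHypothesis.Theorems.KPlusLogSqLaw
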